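import Literature.NumberTheory.LFunctions.SinnottUnitsModPrimePower
import Mathlib.NumberTheory.Padics.Hensel
import Mathlib.NumberTheory.Padics.RingHoms
import Mathlib.RingTheory.RootsOfUnity.Basic
import Mathlib.Algebra.Order.Ring.Abs
import HarnessLib

/-!
# Teichmüller representatives `V ⊂ ℤ_Mˣ` of the torsion of `(ℤ/M^m)ˣ`

Topic `Literature/NumberTheory/LFunctions`; namespace `Literature.NumberTheory.LFunctions.Sinnott1987`.
THEOREMS ONLY (auxiliary `def`s with bodies; no named facts).

`ℤ_Mˣ = V × U` with `V = μ_{M-1}` (`M` odd), `V = {±1}` (`M = 2`) (W. Sinnott, *On a theorem of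
L. Washington*, Astérisque 147–148 (1987), §1.1).  We realise `V` as the finite set
`teich M = {±η : η^{M-1} = 1} ⊂ ℤ_Mˣ` and prove: reduction modulo `M^m` maps `teich M`
bijectively onto the torsion `IsTors` of `(ℤ/M^m)ˣ` (`depth M ≤ m`; surjectivity by Hensel's lemma
for `X^{M-1} - 1`), `teich M` is closed under `η ↦ -η`, and the elements `η⁻¹`, `η ∈ teich M`, are
pairwise `ℤ`-independent up to sign (`a η₁⁻¹ = b η₂⁻¹`, `a ≠ 0` forces `η₁ = ±η₂`), which is the
"pairwise multiplicative independence of the `Y_j`" in Sinnott's proof of Theorem 3.2.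

## References

* W. Sinnott, *On a theorem of L. Washington*, Astérisque 147–148 (1987), 209–224, §1.1, §3.
  [Sinnott1987]
-/

noncomputable section

open Finset Polynomial

namespace Literature.NumberTheory.LFunctions.Sinnott1987

variable {M : ℕ} [hM : Fact M.Prime]

/-- `M - 1 ≠ 0`. [folklore] -/
instance neZero_sub_one : NeZero (M - 1) := ⟨by have := hM.out.two_le; omega⟩

/-- The **Teichmüller set** `V = {±η : η ∈ ℤ_Mˣ, η^{M-1} = 1}` (`= μ_{M-1}` for odd `M`, `{±1}` for
`M = 2`). [cite: Sinnott1987, §1.1 (`ℤ_pˣ = V × U`)] -/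
def teich (M : ℕ) [Fact M.Prime] : Finset ℤ_[M]ˣ :=
  haveI := Fintype.ofFinite (rootsOfUnity (M - 1) ℤ_[M])
  haveI := Classical.decEq ℤ_[M]ˣ
  (univ.image (fun η : rootsOfUnity (M - 1) ℤ_[M] ↦ (η : ℤ_[M]ˣ))) ∪
    (univ.image (fun η : rootsOfUnity (M - 1) ℤ_[M] ↦ -(η : ℤ_[M]ˣ)))

/-- Membership in `teich M`. [folklore] -/
theorem mem_teich_iff (η : ℤ_[M]ˣ) : η ∈ teich M ↔ η ^ (M - 1) = 1 ∨ (-η) ^ (M - 1) = 1 := by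
  simp only [teich, mem_union, mem_image, mem_univ, true_and]
  constructor
  · rintro (⟨θ, rfl⟩ | ⟨θ, rfl⟩)
    · exact Or.inl ((mem_rootsOfUnity _ _).mp θ.2)
    · right; rw [neg_neg]; exact (mem_rootsOfUnity _ _).mp θ.2
  · rintro (h | h)
    · exact Or.inl ⟨⟨η, (mem_rootsOfUnity _ _).mpr h⟩, rfl⟩
    · exact Or.inr ⟨⟨-η, (mem_rootsOfUnity _ _).mpr h⟩, neg_neg η⟩

/-- `1 ∈ V`. [folklore] -/
theorem one_mem_teich : (1 : ℤ_[M]ˣ) ∈ teich M :=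
  (mem_teich_iff 1).mpr (Or.inl (one_pow _))

/-- `V` is closed under negation. [folklore] -/
theorem neg_mem_teich {η : ℤ_[M]ˣ} (hη : η ∈ teich M) : -η ∈ teich M := by
  rw [mem_teich_iff] at hη ⊢
  rw [neg_neg]
  exact hη.symm

/-- Every element of `V` is a `2(M-1)`-th root of unity. [folklore] -/
theorem pow_two_mul_eq_one_of_mem_teich {η : ℤ_[M]ˣ} (hη : η ∈ teich M) :
    η ^ (2 * (M - 1)) = 1 := by
  rw [mem_teich_iff] at hη
  rcases hη with h | h
  · rw [pow_mul', h, one_pow]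
  · calc η ^ (2 * (M - 1)) = ((-η) ^ 2) ^ (M - 1) := by rw [neg_sq, ← pow_mul]
        _ = ((-η) ^ (M - 1)) ^ 2 := by rw [← pow_mul, ← pow_mul, mul_comm]
        _ = 1 := by rw [h, one_pow]

/-- For odd `M`, `V = μ_{M-1}`. [cite: Sinnott1987, §1.1] -/
theorem pow_eq_one_of_mem_teich (h2 : M ≠ 2) {η : ℤ_[M]ˣ} (hη : η ∈ teich M) :
    η ^ (M - 1) = 1 := by
  rw [mem_teich_iff] at hη
  rcases hη with h | h
  · exact h
  · rwa [(hM.out.even_sub_one h2).neg_pow] at h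

/-- For `M = 2`, `V = {±1}`. [cite: Sinnott1987, §1.1] -/
theorem eq_or_eq_neg_of_mem_teich (h2 : M = 2) {η : ℤ_[M]ˣ} (hη : η ∈ teich M) :
    η = 1 ∨ η = -1 := by
  subst h2
  rw [mem_teich_iff, show (2 : ℕ) - 1 = 1 from rfl, pow_one, pow_one] at hη
  rcases hη with h | h
  · exact Or.inl h
  · right; rw [← neg_neg η, h]

/-! ### Reduction modulo `M^m` -/

/-- Reduction of units of `ℤ_M` modulo `M^m`. [folklore] -/
def redUnits (m : ℕ) : ℤ_[M]ˣ →* (ZMod (M ^ m))ˣ :=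
  Units.map ((PadicInt.toZModPow m : ℤ_[M] →+* ZMod (M ^ m)) : ℤ_[M] →* ZMod (M ^ m))

/-- The value of `redUnits`. [folklore] -/
theorem coe_redUnits (m : ℕ) (x : ℤ_[M]ˣ) :
    ((redUnits m x : (ZMod (M ^ m))ˣ) : ZMod (M ^ m)) = PadicInt.toZModPow m (x : ℤ_[M]) := rfl

/-- The value of `redUnits` on inverses. [folklore] -/
theorem coe_redUnits_inv (m : ℕ) (x : ℤ_[M]ˣ) :
    (((redUnits m x)⁻¹ : (ZMod (M ^ m))ˣ) : ZMod (M ^ m)) =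
      PadicInt.toZModPow m ((x⁻¹ : ℤ_[M]ˣ) : ℤ_[M]) := by
  rw [← map_inv]; rfl

/-- `redUnits` commutes with negation. [folklore] -/
theorem redUnits_neg (m : ℕ) (x : ℤ_[M]ˣ) : redUnits m (-x) = -redUnits m x := by
  unfold redUnits; exact Units.map_neg _ _

/-- **The reduction of `V` lies in the torsion of `(ℤ/M^m)ˣ`.** [cite: Sinnott1987, §1.1] -/
theorem isTors_redUnits {m : ℕ} {η : ℤ_[M]ˣ} (hη : η ∈ teich M) : IsTors (redUnits m η) := by
  unfold IsTors
  by_cases h2 : M = 2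
  · left; refine ⟨h2, ?_⟩
    rcases eq_or_eq_neg_of_mem_teich h2 hη with rfl | rfl
    · exact Or.inl (map_one _)
    · right; rw [redUnits_neg, map_one]
  · right; exact ⟨h2, by rw [← map_pow, pow_eq_one_of_mem_teich h2 hη, map_one]⟩

/-- A unit `x ∈ ℤ_Mˣ` reduces to a unit `≡ 1 (mod M)` iff `‖x - 1‖ < 1`. [folklore] -/
theorem congOne_one_redUnits_iff {m : ℕ} (hm : 1 ≤ m) (x : ℤ_[M]ˣ) :
    CongOne 1 ((redUnits m x : (ZMod (M ^ m))ˣ) : ZMod (M ^ m)) ↔ ‖(x : ℤ_[M]) - 1‖ < 1 := by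
  rw [congOne_iff_castHom hm, coe_redUnits, ZMod.castHom_apply, PadicInt.cast_toZModPow 1 m hm,
    ← sub_eq_zero,
    ← map_one (PadicInt.toZModPow 1), ← map_sub, ← RingHom.mem_ker, PadicInt.ker_toZModPow,
    Ideal.mem_span_singleton, pow_one, PadicInt.norm_lt_one_iff_dvd]

/-- The lift `(ũ : ℤ_M)` of the representative of a unit of `ℤ/M^m` is a unit reducing to `u`.
[folklore] -/
theorem isUnit_natCast_val {m : ℕ} (hm : 1 ≤ m) (u : (ZMod (M ^ m))ˣ) :
    IsUnit (((u : ZMod (M ^ m)).val : ℤ_[M])) := by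
  rw [PadicInt.isUnit_iff, PadicInt.norm_natCast_eq_one_iff]
  exact Nat.Coprime.coprime_dvd_left (dvd_pow_self M (by omega))
    (ZMod.val_coe_unit_coprime u).symm

/-- The unit `ũ ∈ ℤ_Mˣ` attached to `u` reduces to `u`. [folklore] -/
theorem redUnits_unit_natCast_val {m : ℕ} (hm : 1 ≤ m) (u : (ZMod (M ^ m))ˣ) :
    redUnits m (isUnit_natCast_val hm u).unit = u := by
  ext
  rw [coe_redUnits, IsUnit.unit_spec, map_natCast, ZMod.natCast_zmod_val]

/-! ### Hensel's lemma for `X^{M-1} - 1` -/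

/-- The polynomial `X^{M-1} - 1 ∈ ℤ[X]`. [folklore] -/
def teichPoly (M : ℕ) : ℤ[X] := X ^ (M - 1) - 1

/-- `aeval a (X^{M-1} - 1) = a^{M-1} - 1`. [folklore] -/
theorem aeval_teichPoly (a : ℤ_[M]) : (teichPoly M).aeval a = a ^ (M - 1) - 1 := by
  simp [teichPoly]

/-- The derivative `(M-1) a^{M-2}` of `X^{M-1} - 1` at a unit `a` is a unit of `ℤ_M`. [folklore] -/
theorem norm_aeval_derivative_teichPoly {a : ℤ_[M]} (ha : IsUnit a) :
    ‖(derivative (teichPoly M)).aeval a‖ = 1 := by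
  have hd : derivative (teichPoly M) = C ((M - 1 : ℕ) : ℤ) * X ^ (M - 1 - 1) := by
    rw [teichPoly, derivative_sub, derivative_one, sub_zero, derivative_X_pow]
  rw [hd, map_mul, aeval_C, map_pow, aeval_X, map_natCast]
  rw [← PadicInt.isUnit_iff]
  refine IsUnit.mul ?_ (ha.pow _)
  rw [PadicInt.isUnit_iff, PadicInt.norm_natCast_eq_one_iff]
  exact (Nat.coprime_self_sub_right hM.out.one_lt.le).mpr (Nat.coprime_one_right M)

/-- **Surjectivity of the reduction `V → V(ℤ/M^m)`** (`1 ≤ m`, `depth M ≤ m`): every torsion unit of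
`ℤ/M^m` is the reduction of an element of `teich M` (Hensel's lemma for `X^{M-1} - 1`).
[cite: Sinnott1987, §1.1] -/
theorem exists_mem_teich_redUnits_eq {m : ℕ} (hm : depth M ≤ m) {u : (ZMod (M ^ m))ˣ}
    (hu : IsTors u) : ∃ η ∈ teich M, redUnits m η = u := by
  have hm1 : 1 ≤ m := le_trans (one_le_depth M) hm
  by_cases h2 : M = 2
  · unfold IsTors at hu
    rcases hu with ⟨-, rfl | rfl⟩ | ⟨h2', -⟩
    · exact ⟨1, one_mem_teich, map_one _⟩
    · exact ⟨-1, neg_mem_teich one_mem_teich, by rw [redUnits_neg, map_one]⟩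
    · exact absurd h2 h2'
  · have hu' : u ^ (M - 1) = 1 := by
      unfold IsTors at hu
      rcases hu with ⟨h2', -⟩ | ⟨-, h⟩
      · exact absurd h2' h2
      · exact h
    -- Hensel at the lift `a` of `u`
    set a : ℤ_[M] := ((u : ZMod (M ^ m)).val : ℤ_[M]) with ha
    have haunit : IsUnit a := isUnit_natCast_val hm1 u
    have hred : redUnits m haunit.unit = u := redUnits_unit_natCast_val hm1 u
    have hnorm : ‖(teichPoly M).aeval a‖ < ‖(derivative (teichPoly M)).aeval a‖ ^ 2 := by
      rw [norm_aeval_derivative_teichPoly haunit, one_pow, PadicInt.norm_lt_one_iff_dvd,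
        ← Ideal.mem_span_singleton]
      have hker : (teichPoly M).aeval a ∈ RingHom.ker (PadicInt.toZModPow m) := by
        rw [RingHom.mem_ker, aeval_teichPoly, map_sub, map_pow, map_one]
        have : PadicInt.toZModPow m a = (u : ZMod (M ^ m)) := by
          rw [ha, map_natCast, ZMod.natCast_zmod_val]
        rw [this, ← Units.val_pow_eq_pow_val, hu', Units.val_one, sub_self]
      rw [PadicInt.ker_toZModPow] at hker
      exact Ideal.span_singleton_le_span_singleton.mpr (dvd_pow_self _ (by omega)) hker
    obtain ⟨z, hz, hza, -, -⟩ := hensels_lemma hnorm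
    rw [norm_aeval_derivative_teichPoly haunit] at hza
    rw [aeval_teichPoly, sub_eq_zero] at hz
    have hzunit : IsUnit z := IsUnit.of_pow_eq_one hz (NeZero.ne _)
    set η : ℤ_[M]ˣ := hzunit.unit with hη
    have hηpow : η ^ (M - 1) = 1 := by
      ext; rw [Units.val_pow_eq_pow_val, IsUnit.unit_spec, hz, Units.val_one]
    have hηmem : η ∈ teich M := (mem_teich_iff η).mpr (Or.inl hηpow)
    refine ⟨η, hηmem, ?_⟩
    -- `redUnits m η · u⁻¹` is torsion and `≡ 1 (mod M)`, hence `1`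
    have hv : redUnits m (η * haunit.unit⁻¹) = 1 := by
      refine eq_one_of_isTors_of_congOne hm ?_ ?_
      · rw [map_mul, map_inv, hred]
        exact (isTors_redUnits hηmem).mul hu.inv
      · have hd : depth M = 1 := by unfold depth; rw [if_neg h2]
        rw [hd, congOne_one_redUnits_iff hm1]
        have hcalc : ((η * haunit.unit⁻¹ : ℤ_[M]ˣ) : ℤ_[M]) - 1 = (z - a) * ((haunit.unit⁻¹ : ℤ_[M]ˣ) : ℤ_[M]) := by
          rw [sub_mul, Units.val_mul, IsUnit.unit_spec]
          congr 1
          exact (haunit.mul_val_inv).symm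
        rw [hcalc, norm_mul]
        calc ‖z - a‖ * ‖((haunit.unit⁻¹ : ℤ_[M]ˣ) : ℤ_[M])‖ ≤ ‖z - a‖ * 1 :=
              mul_le_mul_of_nonneg_left (PadicInt.norm_le_one _) (norm_nonneg _)
          _ < 1 := by rw [mul_one]; exact hza
    rw [map_mul, map_inv, hred, mul_inv_eq_one] at hv
    exact hv

/-- **Injectivity of the reduction `V → (ℤ/M^m)ˣ`** for `depth M ≤ m` (Hensel uniqueness for
`X^{M-1} - 1` at `1`; for `M = 2`, `1 ≢ -1 (mod 4)`). [cite: Sinnott1987, §1.1] -/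
theorem redUnits_injOn_teich {m : ℕ} (hm : depth M ≤ m) :
    Set.InjOn (redUnits (M := M) m) (teich M) := by
  have hm1 : 1 ≤ m := le_trans (one_le_depth M) hm
  intro η₁ h₁ η₂ h₂ h
  rw [mem_coe] at h₁ h₂
  by_cases h2 : M = 2
  · -- `V = {±1}` and `1 ≠ -1` modulo `2^m`, `m ≥ 2`
    subst h2
    have hm2 : 2 ≤ m := by unfold depth at hm; rwa [if_pos rfl] at hm
    have hne : redUnits m (1 : ℤ_[2]ˣ) ≠ redUnits m (-1) := by
      rw [redUnits_neg, map_one]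
      intro h'
      have h1 : (1 : ZMod (2 ^ m)) = -1 := by
        have := congrArg (fun u : (ZMod (2 ^ m))ˣ ↦ (u : ZMod (2 ^ m))) h'
        simpa using this
      have h1' : (1 : ZMod (2 ^ m)) + 1 = 0 := eq_neg_iff_add_eq_zero.mp h1
      have h2' : ((2 : ℕ) : ZMod (2 ^ m)) = 0 := by rw [← h1']; norm_num
      rw [ZMod.natCast_eq_zero_iff] at h2'
      have := Nat.le_of_dvd (by norm_num) h2'
      have : 2 ^ 2 ≤ 2 ^ m := Nat.pow_le_pow_right (by norm_num) hm2
      omega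
    rcases eq_or_eq_neg_of_mem_teich rfl h₁ with rfl | rfl <;>
      rcases eq_or_eq_neg_of_mem_teich rfl h₂ with rfl | rfl
    · rfl
    · exact absurd h hne
    · exact absurd h.symm hne
    · rfl
  · -- Hensel uniqueness at `a = 1`
    set θ := η₁ * η₂⁻¹ with hθ
    have hθ1 : redUnits m θ = 1 := by rw [hθ, map_mul, map_inv, h, mul_inv_cancel]
    have hθnorm : ‖(θ : ℤ_[M]) - 1‖ < 1 := by
      rw [← congOne_one_redUnits_iff hm1, hθ1]
      exact congOne_one 1 hm1
    have hθpow : (θ : ℤ_[M]) ^ (M - 1) = 1 := by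
      rw [← Units.val_pow_eq_pow_val, hθ, mul_pow, inv_pow, pow_eq_one_of_mem_teich h2 h₁,
        pow_eq_one_of_mem_teich h2 h₂, inv_one, mul_one, Units.val_one]
    have hnorm : ‖(teichPoly M).aeval (1 : ℤ_[M])‖ < ‖(derivative (teichPoly M)).aeval (1 : ℤ_[M])‖ ^ 2 := by
      rw [norm_aeval_derivative_teichPoly isUnit_one, aeval_teichPoly, one_pow, sub_self, norm_zero]
      norm_num
    obtain ⟨z, -, -, -, huniq⟩ := hensels_lemma hnorm
    rw [norm_aeval_derivative_teichPoly isUnit_one] at huniq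
    have hz1 : (1 : ℤ_[M]) = z := huniq 1 (by rw [aeval_teichPoly, one_pow, sub_self]) (by simp)
    have hzθ : (θ : ℤ_[M]) = z := huniq θ (by rw [aeval_teichPoly, hθpow, sub_self]) hθnorm
    have : θ = 1 := by ext; rw [hzθ, ← hz1, Units.val_one]
    rw [hθ, mul_inv_eq_one] at this
    exact this

/-- **Reduction is a bijection `V → V(ℤ/M^m)`**: sums over the torsion of `(ℤ/M^m)ˣ` are sums over
`teich M` (`depth M ≤ m`). [cite: Sinnott1987, §1.1, (3.3)] -/
theorem sum_filter_isTors_eq_sum_teich {β : Type*} [AddCommMonoid β] {m : ℕ} (hm : depth M ≤ m)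
    (f : (ZMod (M ^ m))ˣ → β) :
    ∑ v ∈ univ.filter (fun v : (ZMod (M ^ m))ˣ ↦ IsTors v), f v = ∑ η ∈ teich M, f (redUnits m η) := by
  classical
  symm
  refine Finset.sum_nbij (redUnits m) (fun η hη ↦ ?_) (redUnits_injOn_teich hm) (fun v hv ↦ ?_)
    (fun _ _ ↦ rfl)
  · exact mem_filter.mpr ⟨mem_univ _, isTors_redUnits hη⟩
  · rw [mem_coe, mem_filter] at hv
    obtain ⟨η, hη, rfl⟩ := exists_mem_teich_redUnits_eq hm hv.2
    exact ⟨η, mem_coe.mpr hη, rfl⟩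

/-! ### Pairwise independence of the `η⁻¹` up to sign -/

/-- **`a η₁⁻¹ = b η₂⁻¹` in `ℤ_M` with `a, b ∈ ℤ`, `a ≠ 0`, forces `η₁ = ±η₂`** (`η_i ∈ V`): raise to the
power `2(M-1)`. This is the pairwise multiplicative independence of Sinnott's `Y_j = z^{1/η_j}`.
[cite: Sinnott1987, proof of Theorem 3.2 ("the `Y_j`'s are pairwise multiplicatively independent")] -/
theorem eq_or_eq_neg_of_zsmul_inv_eq {η₁ η₂ : ℤ_[M]ˣ} (h₁ : η₁ ∈ teich M) (h₂ : η₂ ∈ teich M)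
    {a b : ℤ} (ha : a ≠ 0)
    (h : (a : ℤ_[M]) * ((η₁⁻¹ : ℤ_[M]ˣ) : ℤ_[M]) = (b : ℤ_[M]) * ((η₂⁻¹ : ℤ_[M]ˣ) : ℤ_[M])) :
    η₁ = η₂ ∨ η₁ = -η₂ := by
  set L := 2 * (M - 1) with hL
  have hL0 : L ≠ 0 := by have := hM.out.two_le; omega
  have hpow : ∀ {η : ℤ_[M]ˣ}, η ∈ teich M → ((η⁻¹ : ℤ_[M]ˣ) : ℤ_[M]) ^ L = 1 := fun hη ↦ by
    rw [← Units.val_pow_eq_pow_val, inv_pow, pow_two_mul_eq_one_of_mem_teich hη, inv_one, Units.val_one]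
  have hab : (a : ℤ_[M]) ^ L = (b : ℤ_[M]) ^ L := by
    have := congrArg (· ^ L) h
    simpa only [mul_pow, hpow h₁, hpow h₂, mul_one] using this
  have hab' : a ^ L = b ^ L := by exact_mod_cast hab
  rcases (pow_eq_pow_iff_of_ne_zero hL0).mp hab' with rfl | ⟨rfl, -⟩
  · left
    have : ((η₁⁻¹ : ℤ_[M]ˣ) : ℤ_[M]) = ((η₂⁻¹ : ℤ_[M]ˣ) : ℤ_[M]) :=
      mul_left_cancel₀ (by exact_mod_cast ha) h
    exact inv_injective (Units.ext this)
  · right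
    have h' : ((-b : ℤ) : ℤ_[M]) * ((η₁⁻¹ : ℤ_[M]ˣ) : ℤ_[M]) =
        ((-b : ℤ) : ℤ_[M]) * -((η₂⁻¹ : ℤ_[M]ˣ) : ℤ_[M]) := by
      rw [h]; push_cast; ring
    have hb : ((-b : ℤ) : ℤ_[M]) ≠ 0 := by exact_mod_cast ha
    have : ((η₁⁻¹ : ℤ_[M]ˣ) : ℤ_[M]) = -((η₂⁻¹ : ℤ_[M]ˣ) : ℤ_[M]) := mul_left_cancel₀ hb h'
    have h3 : η₁⁻¹ = -η₂⁻¹ := Units.ext (by rw [this, Units.val_neg])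
    calc η₁ = (η₁⁻¹)⁻¹ := (inv_inv _).symm
      _ = (-η₂⁻¹)⁻¹ := by rw [h3]
      _ = -η₂ := by rw [inv_neg, inv_inv]

end Literature.NumberTheory.LFunctions.Sinnott1987
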